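import Summits.BirchSwinnertonDyer.BirchSwinnertonDyer.Theorems.QuadraticBranchSignedControlPlusEtaNonsurjMultiplicativeFrobeniusSign
import Summits.BirchSwinnertonDyer.Rank1Residual.X2.CongruentPartnerTrace
import Literature.NumberTheory.EllipticCurves.MultiplicativeUnipotentTorsionProofs
import Literature.NumberTheory.EllipticCurves.SelmerInertiaProofs
import Literature.NumberTheory.EllipticCurves.IsogenyFrobeniusTraceProofs
import Summits.BirchSwinnertonDyer.BirchSwinnertonDyer.Theorems.QuadraticBranchSignedControlPlusEtaNonsurjCartanFieldFrobenius
import Literature.NumberTheory.EllipticCurves.LFunctionPrimeCoeffMultiplicative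
import HarnessLib

/-!
# Route `QuadraticBranchSignedControl` (rung K8, cell `bsd-potss`): crux stmt-BirchSwinnertonDyer-19606
# `PlusEtaMainConjectureNonsurj` — ON A ROW, `ρ̄_{V,p}` IS UNRAMIFIED AT EVERY MULTIPLICATIVE `ℓ ≠ p`, `Frob_ℓ` ACTS ON
# `V[p]` AS THE SCALAR `a_ℓ(V) = ±1` WHEN `ℓ ≡ 1 (mod p)`, AND `Frob_ℓ² = 1` ALWAYS (part 3b of «multiplicative primes `≡ ±1`»)

WHAT. Row consequences of parts 1–3a (`…MultiplicativeFrobenius`, `…MultiplicativeCongruence`,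
`…MultiplicativeFrobeniusSign`) for a row of crux 19606 (`V/ℚ` globally minimal, `p ≥ 5` good, `a_p = 0`, `p`-adic
tower not onto; image `C_ns⁺(p)`), a multiplicative prime `ℓ ≠ p`, a prime `𝔓 ∣ ℓ` of `ℤ̄` and an arithmetic Frobenius
`σ ∈ Γ_ℚ` at `𝔓`:

* §7a `smul_eq_self_of_mem_inertia_of_hasMultiplicativeReduction_of_row` — **`I_𝔓` acts trivially on `V[p]`** (`ρ̄`
  unramified at `ℓ`): the local inertia group acts unipotently on the `p`-torsion of a Tate curve
  (`smul_smul_sub_eq_of_mem_inertia_of_hasMultiplicativeReductionAt`; local-to-global by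
  `exists_mem_inertia_apply_eq_holds`, `resGalOfEmb_eq_of_apply_eq`, conjugation by the X2 cell's
  `CongruentPartnerTrace.conj_mem_inertia_of_mem`), and an
  `X_ns⁺(p)` row has no transvection (`smul_eq_self_of_transvection_of_row`). (Numerically: `p ∣ v_ℓ(Δ_min)`,
  `…SteinbergHandleIdle`.)
* §7b `exists_frob_smul_eq_conj_resGalOfEmb_of_row` — bookkeeping: `σ = j · g τ|_{ℚ̄} g⁻¹` on `V[p]` with `j ∈ I_𝔓`
  trivial, for a local arithmetic Frobenius `τ` (Mathlib `IsArithFrobAt.mul_inv_mem_inertia`, `.conj`;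
  `exists_smul_eq_of_mem_primesAbove_holds`).
* §7c **`frob_smul_eq_self_of_split_of_natCast_eq_one_of_row`** — `ℓ` SPLIT and `ℓ ≡ 1 (mod p)` ⟹ `σ = 1` on `V[p]`
  (`ℓ` splits completely in `ℚ(V[p])`); **`frob_smul_eq_neg_of_not_split_of_natCast_eq_one_of_row`** — `ℓ` NON-SPLIT
  and `ℓ ≡ 1` ⟹ `σ = −1` on `V[p]`; i.e. `Frob_ℓ = a_ℓ(V)` on `V[p]` — the matrix of `τ|_{ℚ̄}` lies in `C_ns(ε)`
  (part 2) with the rational eigenvalue `±ℓ = ±1` (part 3a), hence is that scalar (§6 of part 3a).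
* §7d **`frob_smul_smul_eq_self_of_row`** — for EVERY multiplicative `ℓ ≠ p`: `σ² = 1` on `V[p]` (scalar `±1` when
  `ℓ ≡ 1`; on the coset `M² = −det M = −ℓ = 1` when `ℓ ≡ −1`): `Frob_ℓ` has order `≤ 2` in `Gal(ℚ(V[p])/ℚ)`.
* §7e **`trace_resGalOfEmb_eq_lFunction_mul_of_row`** — the TRACE FORM: `tr ρ̄(τ|_{ℚ̄}) = a_ℓ(V)·(ℓ + 1)` in `𝔽_p`, with
  `a_ℓ(V) = W.LFunction ℓ = ±1` Mathlib's Hasse–Weil coefficient (`LFunction_apply_prime_of_hasSplitMultiplicativeReductionAtPrime`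
  / `…_of_not_split`) — the level-raising shape `a_ℓ(θ_ψ) ≡ a_ℓ(V)(ℓ+1) (mod 𝔓)` observed in FINDING-19606-k8eta-c2-g11 §2b
  at 7/7 multiplicative primes of the matched rows (via `ρ̄_{θ_ψ} ≅ ρ̄_V`).

HONEST FRAMING (cell `bsd-potss`, run/shared/lean/pub/bsd-potss/; FULL-BSD rank ≤ 1 programme): TOOL THEOREMS ONLY
(no definition, no named fact, no `sorry`, axioms standard). Nothing is booked; crux 19606 stays OPEN; `BSD(W, p)` is
claimed for no pair. Seat `bsd-potss-k8eta-c2` g12 (prover), `--supports stmt-BirchSwinnertonDyer-19606`.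

References: [SilvermanATAEC1994] V.4–V.5, Ex. 5.13 (b) (inertia unipotent), Lemma V.5.2 (c), Thm. V.5.3, Cor. V.5.4;
[Serre1972] §1.11–§1.12, §2.2; [NeukirchANT1999] Ch. I §9 (9.4), Ch. II §9 (9.6); K. Ribet, Invent. Math. 100 (1990) §1
(the trace form of the local structure at `ℓ ∥ N`).
-/

set_option autoImplicit false
set_option linter.dupNamespace false

noncomputable section

open scoped Classical NNReal Pointwise

open Matrix Field IsDedekindDomain NumberField WeierstrassCurve Literature.NumberTheory.EllipticCurves
  Literature.NumberTheory.GaloisRepresentations Literature.NumberTheory.SerreUniformity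
  Rat.HeightOneSpectrum IsDedekindDomain.HeightOneSpectrum
  Summit.BirchSwinnertonDyer.Rank1Residual.X2

namespace Summit.BirchSwinnertonDyer.BirchSwinnertonDyer.Theorems.EtaCartanField
/-! ## §7 Rows of crux 19606: `ρ̄` unramified at `ℓ`; `Frob_ℓ = a_ℓ(V)` on `V[p]` when `ℓ ≡ 1`; `Frob_ℓ² = 1` -/

section Row

variable (V : WeierstrassCurve ℚ) [V.IsElliptic] [V.IsGloballyMinimal] (p : ℕ) [hp : Fact p.Prime]

/-- **`ρ̄_{V,p}` is UNRAMIFIED at every multiplicative `ℓ ≠ p` of a row.** On a row of crux 19606 (`V/ℚ` globally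
minimal, `p ≥ 5` good, `a_p = 0`, tower not onto), for a multiplicative prime `ℓ ≠ p`, every prime `𝔓 ∣ ℓ` of `ℤ̄`
and every `j ∈ I_𝔓`: `j` acts trivially on `V[p]`. (The inertia group at a multiplicative place acts unipotently —
`smul_smul_sub_eq_of_mem_inertia_of_hasMultiplicativeReductionAt`, local-to-global by
`exists_mem_inertia_apply_eq_holds` — and a unipotent element acts trivially on an `X_ns⁺(p)` row,
`smul_eq_self_of_transvection_of_row`; equivalently `p ∣ v_ℓ(Δ_min)`, `…SteinbergHandleIdle`.)
[cite: SilvermanATAEC1994, V.4–V.5 and Exercise 5.13 (b) (PDF p. 416)] [cite: Serre1972, §2.2]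
[cite: NeukirchANT1999, Ch. II §9 Prop. (9.6)] -/
theorem smul_eq_self_of_mem_inertia_of_hasMultiplicativeReduction_of_row (hp5 : 5 ≤ p)
    (hgood : V.HasGoodReductionAtPrime p) (hap : V.frobeniusTrace p = 0)
    (hns : ¬ ∀ m : ℕ, V.HasSurjectiveModNGaloisRep (p ^ m : ℕ)) (ℓ : ℕ) [hℓ : Fact ℓ.Prime] (hℓp : ℓ ≠ p)
    (hmult : V.HasMultiplicativeReductionAtPrime ℓ) {v : HeightOneSpectrum (𝓞 ℚ)} (hv : (primesEquiv v : ℕ) = ℓ)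
    {𝔓 : Ideal (absIntegers (𝓞 ℚ) ℚ)} (h𝔓 : 𝔓 ∈ v.primesAbove) {j : absoluteGaloisGroup ℚ}
    (hj : j ∈ 𝔓.inertia (absoluteGaloisGroup ℚ)) (P : V.geomTorsion p) : j • P = P := by
  have hpp : p.Prime := hp.out
  have hmultAt : V.HasMultiplicativeReductionAt v := hasMultiplicativeReductionAt_of_primesEquiv_eq V hmult hv
  have hpv : (p : 𝓞 ℚ) ∉ v.asIdeal := natCast_not_mem_asIdeal_of_primesEquiv_ne hpp (hv ▸ hℓp)
  obtain ⟨w, hw⟩ := v.exists_spectralValuation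
  obtain ⟨𝔐, h𝔐⟩ := v.localPrimesAbove_nonempty
  set ι := closureEmb (K := ℚ) (v.adicCompletion ℚ) with hι
  have h𝔓₁ : v.primeBelow ι 𝔐 ∈ v.primesAbove := primeBelow_mem_primesAbove h𝔐
  obtain ⟨g, hg⟩ := exists_smul_eq_of_mem_primesAbove_holds (K := ℚ) (v := v) h𝔓₁ h𝔓
  -- `j₁ = g⁻¹ j g ∈ I_{𝔓₁}` comes from the local inertia group
  have hj₁ : g⁻¹ * j * g ∈ (v.primeBelow ι 𝔐).inertia (absoluteGaloisGroup ℚ) := by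
    rw [← hg] at hj
    exact CongruentPartnerTrace.conj_mem_inertia_of_mem hj
  obtain ⟨σ, hσI, hσj⟩ := IsDedekindDomain.HeightOneSpectrum.exists_mem_inertia_apply_eq_holds v ι h𝔐 hj₁
  have hjres : resGalOfEmb ι σ = g⁻¹ * j * g := resGalOfEmb_eq_of_apply_eq ι hσj
  -- `σ` acts unipotently on the `p`-torsion of `V(ℚ̄_v)`, hence `j₁` on `V[p]`
  have hinj : Function.Injective (pointsMapOfEmb V ι) := pointsMapOfEmb_injective V ι
  have hunip : ∀ Q : V.geomTorsion p, (g⁻¹ * j * g) • ((g⁻¹ * j * g) • Q) + Q =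
      (g⁻¹ * j * g) • Q + (g⁻¹ * j * g) • Q := by
    intro Q
    have hQ' : p ^ 1 • pointsMapOfEmb V ι (Q : geomPoints V) = 0 := by
      rw [pow_one, ← map_nsmul, ← natCast_zsmul]
      have h2 : ((p : ℕ) : ℤ) • (Q : geomPoints V) = 0 := (Submodule.mem_torsionBy_iff _ _).mp Q.2
      rw [h2, map_zero]
    have key := V.smul_smul_sub_eq_of_mem_inertia_of_hasMultiplicativeReductionAt hmultAt hpp hpv (le_refl 1)
      hw h𝔐 hσI (pointsMapOfEmb V ι (Q : geomPoints V)) hQ'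
    have key' : (g⁻¹ * j * g) • ((g⁻¹ * j * g) • (Q : geomPoints V) - Q) = (g⁻¹ * j * g) • (Q : geomPoints V) - Q := by
      apply hinj
      rw [← hjres]
      simp only [map_sub, pointsMapOfEmb_smul]
      exact key
    apply Subtype.ext
    simp only [AddSubgroup.coe_add, Literature.NumberTheory.EllipticCurves.AddSubgroup.torsionBy.coe_smul]
    rw [smul_sub] at key'
    exact sub_eq_sub_iff_add_eq_add.mp key'
  have htriv := smul_eq_self_of_transvection_of_row V p hp5 hgood hap hns hunip
  -- `j = g j₁ g⁻¹`
  have hjeq : j = g * (g⁻¹ * j * g) * g⁻¹ := by group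
  rw [hjeq, mul_smul, mul_smul, htriv (g⁻¹ • P), smul_inv_smul]

/-- **Frobenius at a multiplicative `ℓ ≠ p` equals the restricted local Frobenius on `V[p]`, up to conjugation**:
bookkeeping lemma — for `𝔓 ∣ ℓ` and `σ` an arithmetic Frobenius at `𝔓` there are `g ∈ Γ_ℚ`, a prime `𝔐` of
`\bar ℤ_ℓ` and a local arithmetic Frobenius `τ` with `σ • P = g • (τ|_{ℚ̄} • (g⁻¹ • P))` for all `P ∈ V[p]`
(`σ = j · g τ|_{ℚ̄} g⁻¹`, `j ∈ I_𝔓` acting trivially). [cite: NeukirchANT1999, Ch. I §9 (9.4), Ch. II §9 (9.6)] -/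
theorem exists_frob_smul_eq_conj_resGalOfEmb_of_row (hp5 : 5 ≤ p) (hgood : V.HasGoodReductionAtPrime p)
    (hap : V.frobeniusTrace p = 0) (hns : ¬ ∀ m : ℕ, V.HasSurjectiveModNGaloisRep (p ^ m : ℕ)) (ℓ : ℕ)
    [hℓ : Fact ℓ.Prime] (hℓp : ℓ ≠ p) (hmult : V.HasMultiplicativeReductionAtPrime ℓ)
    {v : HeightOneSpectrum (𝓞 ℚ)} (hv : (primesEquiv v : ℕ) = ℓ) {𝔓 : Ideal (absIntegers (𝓞 ℚ) ℚ)}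
    (h𝔓 : 𝔓 ∈ v.primesAbove) {σ : absoluteGaloisGroup ℚ} (hσ : IsArithFrobAt (𝓞 ℚ) σ 𝔓) :
    ∃ (g : absoluteGaloisGroup ℚ) (𝔐 : Ideal v.localAbsIntegers) (_ : 𝔐 ∈ v.localPrimesAbove)
      (τ : absoluteGaloisGroup (v.adicCompletion ℚ)), IsArithFrobAt (v.adicCompletionIntegers ℚ) τ 𝔐 ∧
      ∀ P : V.geomTorsion p, σ • P = g • (resGalOfEmb (closureEmb (K := ℚ) (v.adicCompletion ℚ)) τ • (g⁻¹ • P)) := by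
  obtain ⟨𝔐, h𝔐⟩ := v.localPrimesAbove_nonempty
  obtain ⟨τ, hτ⟩ := exists_isArithFrobAt_localAbsIntegers v h𝔐
  set ι := closureEmb (K := ℚ) (v.adicCompletion ℚ) with hι
  set σ₁ : absoluteGaloisGroup ℚ := resGalOfEmb ι τ with hσ₁
  have h𝔓₁ : v.primeBelow ι 𝔐 ∈ v.primesAbove := primeBelow_mem_primesAbove h𝔐
  have hσ₁frob : IsArithFrobAt (𝓞 ℚ) σ₁ (v.primeBelow ι 𝔐) := WeierstrassCurve.isArithFrobAt_resGalOfEmb h𝔐 ι hτ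
  obtain ⟨g, hg⟩ := exists_smul_eq_of_mem_primesAbove_holds (K := ℚ) (v := v) h𝔓₁ h𝔓
  have hσ' : IsArithFrobAt (𝓞 ℚ) (g * σ₁ * g⁻¹) 𝔓 := by rw [← hg]; exact hσ₁frob.conj g
  have hjI : σ * (g * σ₁ * g⁻¹)⁻¹ ∈ 𝔓.inertia (absoluteGaloisGroup ℚ) := hσ.mul_inv_mem_inertia hσ'
  refine ⟨g, 𝔐, h𝔐, τ, hτ, fun P => ?_⟩
  have hσeq : σ = (σ * (g * σ₁ * g⁻¹)⁻¹) * (g * σ₁ * g⁻¹) := by group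
  conv_lhs => rw [hσeq]
  rw [mul_smul, smul_eq_self_of_mem_inertia_of_hasMultiplicativeReduction_of_row V p hp5 hgood hap hns ℓ hℓp hmult hv
    h𝔓 hjI, mul_smul, mul_smul]

/-- **`ℓ` SPLIT multiplicative with `ℓ ≡ 1 (mod p)` ⟹ `Frob_ℓ = 1` on `V[p]`** (for every Frobenius at every `𝔓 ∣ ℓ`;
`ℓ` splits completely in `ℚ(V[p])`): the matrix of `τ|_{ℚ̄}` lies in `C_ns(ε)` (part 2) and has the rational
eigenvalue `+ℓ = 1` (§5), hence is the scalar `1` (§6). [cite: Serre1972, §2.2, §1.11–§1.12]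
[cite: SilvermanATAEC1994, Thm. V.5.3, Thm. V.3.1 (c),(d)] -/
theorem frob_smul_eq_self_of_split_of_natCast_eq_one_of_row (hp5 : 5 ≤ p) (hgood : V.HasGoodReductionAtPrime p)
    (hap : V.frobeniusTrace p = 0) (hns : ¬ ∀ m : ℕ, V.HasSurjectiveModNGaloisRep (p ^ m : ℕ)) (ℓ : ℕ)
    [hℓ : Fact ℓ.Prime] (hℓp : ℓ ≠ p) (hmult : V.HasMultiplicativeReductionAtPrime ℓ)
    {v : HeightOneSpectrum (𝓞 ℚ)} (hv : (primesEquiv v : ℕ) = ℓ) (hsplit : V.HasSplitMultiplicativeReductionAt v)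
    (hℓ1 : (ℓ : ZMod p) = 1) {𝔓 : Ideal (absIntegers (𝓞 ℚ) ℚ)} (h𝔓 : 𝔓 ∈ v.primesAbove)
    {σ : absoluteGaloisGroup ℚ} (hσ : IsArithFrobAt (𝓞 ℚ) σ 𝔓) (P : V.geomTorsion p) : σ • P = P := by
  have hpp : p.Prime := hp.out
  have hp2 : p ≠ 2 := by omega
  obtain ⟨g, 𝔐, h𝔐, τ, hτ, hστ⟩ :=
    exists_frob_smul_eq_conj_resGalOfEmb_of_row V p hp5 hgood hap hns ℓ hℓp hmult hv h𝔓 hσ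
  set σ₁ := resGalOfEmb (closureEmb (K := ℚ) (v.adicCompletion ℚ)) τ with hσ₁
  -- the matrix of `σ₁` is the scalar `ℓ = 1`
  obtain ⟨e, ε, hε, himg, hsurj⟩ := hasModPImageEqNonsplitCartanNormalizer_of_row V p hp5 hgood hap hns
  obtain ⟨M, hM, hσM⟩ := himg σ₁
  obtain ⟨Q, hQ0, hσQ⟩ :=
    exists_eigenvector_resGalOfEmb_of_hasSplitMultiplicativeReductionAt V hsplit hpp hv hℓp h𝔐 hτ
  rw [← hσ₁] at hσQ
  have hMC : M ∈ nonsplitCartan ε := by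
    refine (matrix_mem_nonsplitCartan_iff_centralizes_sq hp2 e hε himg hsurj hM hσM).mpr ?_
    rcases natCast_eq_one_and_centralizes_sq_or_of_row V p hp5 hgood hap hns hℓp hv
        (hasMultiplicativeReductionAt_of_primesEquiv_eq V hmult hv) h𝔐 hτ with ⟨-, hcen⟩ | ⟨hneg, -⟩
    · exact hcen
    · exfalso
      rw [hℓ1] at hneg
      have h2 : ((2 : ℕ) : ZMod p) = 0 := by
        rw [Nat.cast_ofNat]
        linear_combination hneg
      rw [ZMod.natCast_eq_zero_iff] at h2
      have := (Nat.prime_dvd_prime_iff_eq hpp Nat.prime_two).mp h2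
      omega
  have hMx : M *ᵥ e Q = (1 : ZMod p) • e Q := by
    rw [← hσM Q, hσQ, map_zsmul, ← Int.cast_smul_eq_zsmul (ZMod p), Int.cast_natCast, hℓ1]
  have hx0 : e Q ≠ 0 := fun h0 => hQ0 (e.injective (by rw [h0, map_zero]))
  have hM1 : M = 1 := by
    rw [eq_smul_one_of_mem_nonsplitCartan_of_mulVec_eq hε hMC hx0 hMx, one_smul]
  have hσ₁triv : ∀ R : V.geomTorsion p, σ₁ • R = R := fun R =>
    e.injective (by rw [hσM R, hM1, Matrix.one_mulVec])
  rw [hστ P, hσ₁triv, smul_inv_smul]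

/-- **`ℓ` NON-SPLIT multiplicative with `ℓ ≡ 1 (mod p)` ⟹ `Frob_ℓ = −1` on `V[p]`** (every Frobenius at every
`𝔓 ∣ ℓ`): the matrix of `τ|_{ℚ̄}` lies in `C_ns(ε)` with the rational eigenvalue `−ℓ = −1`, hence is the scalar `−1`.
(`ℓ` is odd: `ℓ ≥ p − 1 ≥ 4` by part 2.) [cite: Serre1972, §2.2, §1.11–§1.12]
[cite: SilvermanATAEC1994, Lemma V.5.2 (c), Thm. V.5.3, Cor. V.5.4, Ex. 5.11 (b)] -/
theorem frob_smul_eq_neg_of_not_split_of_natCast_eq_one_of_row (hp5 : 5 ≤ p)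
    (hgood : V.HasGoodReductionAtPrime p) (hap : V.frobeniusTrace p = 0)
    (hns : ¬ ∀ m : ℕ, V.HasSurjectiveModNGaloisRep (p ^ m : ℕ)) (ℓ : ℕ) [hℓ : Fact ℓ.Prime] (hℓp : ℓ ≠ p)
    (hmult : V.HasMultiplicativeReductionAtPrime ℓ) (hnsplit : ¬ V.HasSplitMultiplicativeReductionAtPrime ℓ)
    {v : HeightOneSpectrum (𝓞 ℚ)} (hv : (primesEquiv v : ℕ) = ℓ) (hℓ1 : (ℓ : ZMod p) = 1)
    {𝔓 : Ideal (absIntegers (𝓞 ℚ) ℚ)} (h𝔓 : 𝔓 ∈ v.primesAbove) {σ : absoluteGaloisGroup ℚ}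
    (hσ : IsArithFrobAt (𝓞 ℚ) σ 𝔓) (P : V.geomTorsion p) : σ • P = -P := by
  have hpp : p.Prime := hp.out
  have hp2 : p ≠ 2 := by omega
  have hℓ2 : ℓ ≠ 2 := by
    have := le_add_one_of_hasMultiplicativeReduction_of_row V p hp5 hgood hap hns ℓ hℓp hmult
    omega
  obtain ⟨g, 𝔐, h𝔐, τ, hτ, hστ⟩ :=
    exists_frob_smul_eq_conj_resGalOfEmb_of_row V p hp5 hgood hap hns ℓ hℓp hmult hv h𝔓 hσ
  set σ₁ := resGalOfEmb (closureEmb (K := ℚ) (v.adicCompletion ℚ)) τ with hσ₁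
  obtain ⟨e, ε, hε, himg, hsurj⟩ := hasModPImageEqNonsplitCartanNormalizer_of_row V p hp5 hgood hap hns
  obtain ⟨M, hM, hσM⟩ := himg σ₁
  obtain ⟨Q, hQ0, hσQ⟩ := exists_eigenvector_resGalOfEmb_of_not_hasSplitMultiplicativeReductionAtPrime V hpp hℓ2
    hℓp hmult hnsplit hv h𝔐 hτ
  rw [← hσ₁] at hσQ
  have hMC : M ∈ nonsplitCartan ε := by
    refine (matrix_mem_nonsplitCartan_iff_centralizes_sq hp2 e hε himg hsurj hM hσM).mpr ?_
    rcases natCast_eq_one_and_centralizes_sq_or_of_row V p hp5 hgood hap hns hℓp hv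
        (hasMultiplicativeReductionAt_of_primesEquiv_eq V hmult hv) h𝔐 hτ with ⟨-, hcen⟩ | ⟨hneg, -⟩
    · exact hcen
    · exfalso
      rw [hℓ1] at hneg
      have h2 : ((2 : ℕ) : ZMod p) = 0 := by
        rw [Nat.cast_ofNat]
        linear_combination hneg
      rw [ZMod.natCast_eq_zero_iff] at h2
      have := (Nat.prime_dvd_prime_iff_eq hpp Nat.prime_two).mp h2
      omega
  have hMx : M *ᵥ e Q = (-1 : ZMod p) • e Q := by
    rw [← hσM Q, hσQ, map_zsmul, ← Int.cast_smul_eq_zsmul (ZMod p), Int.cast_neg, Int.cast_natCast, hℓ1]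
  have hx0 : e Q ≠ 0 := fun h0 => hQ0 (e.injective (by rw [h0, map_zero]))
  have hM1 : M = -1 := by
    rw [eq_smul_one_of_mem_nonsplitCartan_of_mulVec_eq hε hMC hx0 hMx, neg_one_smul]
  have hσ₁neg : ∀ R : V.geomTorsion p, σ₁ • R = -R := fun R =>
    e.injective (by rw [hσM R, hM1, Matrix.neg_mulVec, Matrix.one_mulVec, map_neg])
  rw [hστ P, hσ₁neg, smul_neg, smul_inv_smul]

/-- **`Frob_ℓ² = 1` on `V[p]` for every multiplicative `ℓ ≠ p` of a row** (every Frobenius at every `𝔓 ∣ ℓ`): the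
matrix `M` of `τ|_{ℚ̄}` is either a scalar `±ℓ = ±1` of `C_ns(ε)` (when `ℓ ≡ 1`) or an element of the coset with
`M² = −det M = −ℓ = 1` (when `ℓ ≡ −1`). So `Frob_ℓ` has order `≤ 2` in `Gal(ℚ(V[p])/ℚ)`.
[cite: Serre1972, §2.2, §1.11–§1.12] [cite: SilvermanATAEC1994, Lemma V.5.2 (c), Thm. V.5.3, Cor. V.5.4] -/
theorem frob_smul_smul_eq_self_of_row (hp5 : 5 ≤ p) (hgood : V.HasGoodReductionAtPrime p)
    (hap : V.frobeniusTrace p = 0) (hns : ¬ ∀ m : ℕ, V.HasSurjectiveModNGaloisRep (p ^ m : ℕ)) (ℓ : ℕ)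
    [hℓ : Fact ℓ.Prime] (hℓp : ℓ ≠ p) (hmult : V.HasMultiplicativeReductionAtPrime ℓ)
    {v : HeightOneSpectrum (𝓞 ℚ)} (hv : (primesEquiv v : ℕ) = ℓ) {𝔓 : Ideal (absIntegers (𝓞 ℚ) ℚ)}
    (h𝔓 : 𝔓 ∈ v.primesAbove) {σ : absoluteGaloisGroup ℚ} (hσ : IsArithFrobAt (𝓞 ℚ) σ 𝔓)
    (P : V.geomTorsion p) : σ • (σ • P) = P := by
  have hpp : p.Prime := hp.out
  haveI : NeZero p := ⟨hpp.ne_zero⟩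
  have hmultAt := hasMultiplicativeReductionAt_of_primesEquiv_eq V hmult hv
  obtain ⟨g, 𝔐, h𝔐, τ, hτ, hστ⟩ :=
    exists_frob_smul_eq_conj_resGalOfEmb_of_row V p hp5 hgood hap hns ℓ hℓp hmult hv h𝔓 hσ
  set σ₁ := resGalOfEmb (closureEmb (K := ℚ) (v.adicCompletion ℚ)) τ with hσ₁
  obtain ⟨e, ε, hε, himg, hsurj⟩ := hasModPImageEqNonsplitCartanNormalizer_of_row V p hp5 hgood hap hns
  obtain ⟨M, hM, hσM⟩ := himg σ₁
  -- the rational eigenvector of eigenvalue `s ℓ` and `det M = ℓ`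
  obtain ⟨s, hs, Q, hQ0, hσQ⟩ :=
    exists_eigenvector_resGalOfEmb_of_hasMultiplicativeReductionAt V hmultAt hpp hv hℓp h𝔐 hτ
  rw [← hσ₁] at hσQ
  have hx0 : e Q ≠ 0 := fun h0 => hQ0 (e.injective (by rw [h0, map_zero]))
  have hMx : M *ᵥ e Q = ((s : ZMod p) * (ℓ : ZMod p)) • e Q := by
    rw [← hσM Q, hσQ, map_zsmul, ← Int.cast_smul_eq_zsmul (ZMod p), Int.cast_mul, Int.cast_natCast]
  have hs2 : (s : ZMod p) ^ 2 = 1 := by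
    rcases hs with rfl | rfl
    · rw [Int.cast_one, one_pow]
    · rw [Int.cast_neg, Int.cast_one, neg_one_sq]
  have hdet : M.det = (ℓ : ZMod p) := by
    rw [det_eq_modNCyclotomicCharacter V p hpp.two_le e σ₁ M hσM, hσ₁,
      modNCyclotomicCharacter_resGalOfEmb_eq_of_isArithFrobAt hv hℓp h𝔐 hτ]
  -- `M * M = 1` in both cases
  have hMM : M * M = 1 := by
    rcases natCast_eq_one_and_centralizes_sq_or_of_row V p hp5 hgood hap hns hℓp hv hmultAt h𝔐 hτ with
      ⟨hℓ1, -⟩ | ⟨hℓ1, hcen⟩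
    · -- `ℓ ≡ 1`: `M ∈ C_ns(ε)` by the coset lemma of part 1 (else `ℓ = −1`), then scalar `s` with `s² = 1`
      have hℓ0 : (ℓ : ZMod p) ≠ 0 := by rw [hℓ1]; exact one_ne_zero
      have hMC : M ∈ nonsplitCartan ε := by
        by_contra hMC
        have := eq_neg_one_of_not_mem_nonsplitCartan_of_mulVec_eq hM hMC hx0 hs2 hMx hdet hℓ0
        rw [hℓ1] at this
        have h2 : ((2 : ℕ) : ZMod p) = 0 := by
          rw [Nat.cast_ofNat]
          linear_combination this
        rw [ZMod.natCast_eq_zero_iff] at h2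
        have := (Nat.prime_dvd_prime_iff_eq hpp Nat.prime_two).mp h2
        omega
      rw [hℓ1, mul_one] at hMx
      rw [eq_smul_one_of_mem_nonsplitCartan_of_mulVec_eq hε hMC hx0 hMx, smul_mul_smul_comm, mul_one, ← sq, hs2,
        one_smul]
    · have hMC : M ∉ nonsplitCartan ε := fun hMC =>
        hcen ((matrix_mem_nonsplitCartan_iff_centralizes_sq (by omega) e hε himg hsurj hM hσM).mp hMC)
      rw [mul_self_eq_neg_det_smul_one_of_not_mem_nonsplitCartan hM hMC, hdet, hℓ1, neg_neg, one_smul]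
  have hσ₁sq : ∀ R : V.geomTorsion p, σ₁ • (σ₁ • R) = R := fun R =>
    e.injective (by rw [hσM, hσM, Matrix.mulVec_mulVec, hMM, Matrix.one_mulVec])
  rw [hστ P, hστ, inv_smul_smul, hσ₁sq, smul_inv_smul]

/-- **Trace form (the level-raising shape): `tr ρ̄(Frob_ℓ) = a_ℓ(V)·(ℓ+1)` in `𝔽_p`.** On a row, for a multiplicative prime
`ℓ ≠ p`, a local arithmetic Frobenius `τ` and `σ₁ = τ|_{ℚ̄}`: the `𝔽_p`-linear trace of `σ₁` on `V[p]` is `a_ℓ(V)(ℓ+1)`, where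
`a_ℓ(V) = W.LFunction ℓ ∈ {±1}` (`+1` split, `−1` non-split). Cases: `ℓ ≡ 1` ⟹ `ρ̄(σ₁)` is the scalar `a_ℓ` (trace `2a_ℓ = a_ℓ(ℓ+1)`);
`ℓ ≡ −1` ⟹ `ρ̄(σ₁)` lies in the coset of `C_ns(ε)` (trace `0 = a_ℓ(ℓ+1)`). With `ρ̄_{θ} ≅ ρ̄_V` for a congruent newform `θ` this is
`a_ℓ(θ) ≡ a_ℓ(V)(ℓ+1) (mod 𝔓)` (Ribet's level-raising condition at `ℓ ∥ N_V`). [cite: Serre1972, §2.2, §1.11–§1.12]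
[cite: SilvermanAEC2009, Exercise 8.19(a) and §C.16] -/
theorem trace_resGalOfEmb_eq_lFunction_mul_of_row (hp5 : 5 ≤ p) (hgood : V.HasGoodReductionAtPrime p)
    (hap : V.frobeniusTrace p = 0) (hns : ¬ ∀ m : ℕ, V.HasSurjectiveModNGaloisRep (p ^ m : ℕ)) (ℓ : ℕ)
    [hℓ : Fact ℓ.Prime] (hℓp : ℓ ≠ p) (hmult : V.HasMultiplicativeReductionAtPrime ℓ)
    {v : HeightOneSpectrum (𝓞 ℚ)} (hv : (primesEquiv v : ℕ) = ℓ) {𝔐 : Ideal v.localAbsIntegers}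
    (h𝔐 : 𝔐 ∈ v.localPrimesAbove) {τ : absoluteGaloisGroup (v.adicCompletion ℚ)}
    (hτ : IsArithFrobAt (v.adicCompletionIntegers ℚ) τ 𝔐) :
    letI : Module (ZMod p) (V.geomTorsion p) := AddSubgroup.torsionBy.zmodModule
    LinearMap.trace (ZMod p) (V.geomTorsion p)
        ((galoisRepTorsion V p (resGalOfEmb (closureEmb (K := ℚ) (v.adicCompletion ℚ)) τ)).toAdd.toAddMonoidHom.toZModLinearMap
          p) = ((V.LFunction ℓ : ℤ) : ZMod p) * ((ℓ : ZMod p) + 1) := by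
  letI : Module (ZMod p) (V.geomTorsion p) := AddSubgroup.torsionBy.zmodModule
  have hpp : p.Prime := hp.out
  have hp2 : p ≠ 2 := by omega
  haveI : NeZero p := ⟨hpp.ne_zero⟩
  have hℓ2 : ℓ ≠ 2 := by
    have := le_add_one_of_hasMultiplicativeReduction_of_row V p hp5 hgood hap hns ℓ hℓp hmult
    omega
  have hmultAt := hasMultiplicativeReductionAt_of_primesEquiv_eq V hmult hv
  set σ₁ := resGalOfEmb (closureEmb (K := ℚ) (v.adicCompletion ℚ)) τ with hσ₁
  obtain ⟨e, ε, hε, himg, hsurj⟩ := hasModPImageEqNonsplitCartanNormalizer_of_row V p hp5 hgood hap hns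
  obtain ⟨M, hM, hσM⟩ := himg σ₁
  rw [trace_eq_matrix_trace e hσM]
  -- the sign `a = a_ℓ(V) = ±1` and an eigenvector of eigenvalue `a ℓ`
  obtain ⟨a, haL, Q, hQ0, hσQ⟩ : ∃ a : ℤ, V.LFunction ℓ = a ∧ ∃ Q : V.geomTorsion p, Q ≠ 0 ∧ σ₁ • Q = (a * (ℓ : ℤ)) • Q := by
    by_cases hsplit : V.HasSplitMultiplicativeReductionAtPrime ℓ
    · have hsplitAt : V.HasSplitMultiplicativeReductionAt v := by
        have key : ∀ (q : ℕ) (hq : Fact q.Prime), q = ℓ → @WeierstrassCurve.HasSplitMultiplicativeReductionAtPrime V q hq := by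
          rintro q hq rfl; exact hsplit
        exact (hasSplitMultiplicativeReductionAtPrime_iff_hasSplitMultiplicativeReductionAt V v).mp (key _ _ hv)
      obtain ⟨Q, hQ0, hQ⟩ := exists_eigenvector_resGalOfEmb_of_hasSplitMultiplicativeReductionAt V hsplitAt hpp hv hℓp h𝔐 hτ
      exact ⟨1, V.LFunction_apply_prime_of_hasSplitMultiplicativeReductionAtPrime ℓ hsplit, Q, hQ0, by rwa [one_mul]⟩
    · obtain ⟨Q, hQ0, hQ⟩ := exists_eigenvector_resGalOfEmb_of_not_hasSplitMultiplicativeReductionAtPrime V hpp hℓ2 hℓp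
        hmult hsplit hv h𝔐 hτ
      exact ⟨-1, V.LFunction_apply_prime_of_hasMultiplicativeReductionAtPrime_of_not_split ℓ hmult hsplit, Q, hQ0,
        by rwa [neg_one_mul]⟩
  rw [haL]
  have hx0 : e Q ≠ 0 := fun h0 => hQ0 (e.injective (by rw [h0, map_zero]))
  have hMx : M *ᵥ e Q = ((a : ZMod p) * (ℓ : ZMod p)) • e Q := by
    rw [← hσM Q, hσQ, map_zsmul, ← Int.cast_smul_eq_zsmul (ZMod p), Int.cast_mul, Int.cast_natCast]
  rcases natCast_eq_one_and_centralizes_sq_or_of_row V p hp5 hgood hap hns hℓp hv hmultAt h𝔐 hτ with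
    ⟨hℓ1, hcen⟩ | ⟨hℓ1, hcen⟩
  · -- Cartan: scalar `a ℓ = a`, trace `2a = a (ℓ + 1)`
    have hMC : M ∈ nonsplitCartan ε := (matrix_mem_nonsplitCartan_iff_centralizes_sq hp2 e hε himg hsurj hM hσM).mpr hcen
    rw [eq_smul_one_of_mem_nonsplitCartan_of_mulVec_eq hε hMC hx0 hMx, Matrix.trace_smul, Matrix.trace_one,
      Fintype.card_fin, hℓ1, smul_eq_mul]
    ring
  · -- coset: trace `0 = a (ℓ + 1)`
    have hMC : M ∉ nonsplitCartan ε := fun hMC =>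
      hcen ((matrix_mem_nonsplitCartan_iff_centralizes_sq hp2 e hε himg hsurj hM hσM).mp hMC)
    obtain ⟨c, d, -, rfl⟩ := exists_eq_coset_of_not_mem_nonsplitCartan hM hMC
    rw [Matrix.trace_fin_two_of, hℓ1]
    ring

end Row

end Summit.BirchSwinnertonDyer.BirchSwinnertonDyer.Theorems.EtaCartanField

end
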